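import Summits.BirchSwinnertonDyer.BirchSwinnertonDyer.Theses.PrintCf2
import Literature.NumberTheory.EllipticCurves.CongruentNumberEvenMonskySelmerExact
import HarnessLib

/-!
# Route `PrintCf2`, aside stmt-BirchSwinnertonDyer-20588 `HBMonskySelmerEven` — CLOSED by the tree's discharge
# (cell `bsd-print-cf2`, p1)

HONEST FRAMING (cell `bsd-print-cf2`, run/shared/lean/pub/bsd-print-cf2/; route `PrintCf2`, leaf CornerF @ `p = 2`):
a CLOSING file for a by-name ASIDE of the route (planner g2, rev 4: every cite-only cone fact is an item statement
`def <Name> : Prop := <Literature decl>`). The aside `HBMonskySelmerEven` IS the named fact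
`HeathBrown1994.monsky_card_selmerGroup_two_even` (Heath-Brown 1994, Invent. 118, Appendix by Monsky, EVEN case:
`#Sel₂(E_{2m})/E[2] = 2^{2k − rank M}` — conjunct 10 of the ramified bundle `𝔅_ram`), and that fact is a THEOREM of
the tree: `HeathBrown1994.monsky_card_selmerGroup_two_even_holds` (cell `bsd-monsky`, complete `2`-descent,
`Literature/NumberTheory/EllipticCurves/CongruentNumberEvenMonskySelmerExact.lean`). One-line term (the planner's
TURNKEY 15:39:04Z). Nothing new asserted; beyond print: n/a (the appendix prints a sketch proof; the tree's proof is
complete). [cite: HeathBrown1994SelmerCongruentII, Appendix (Monsky), typescript p. 41 L20–L36]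
-/

noncomputable section

open Summit.BirchSwinnertonDyer.BirchSwinnertonDyer.Theses.PrintCf2

set_option autoImplicit false
-- `Summit.BirchSwinnertonDyer.BirchSwinnertonDyer.Theorems` is the layout's namespace (Sub = Summit name).
set_option linter.dupNamespace false

namespace Summit.BirchSwinnertonDyer.BirchSwinnertonDyer.Theorems

/-- **Aside 20588 holds**: Monsky's even-case Selmer count is the tree theorem
`HeathBrown1994.monsky_card_selmerGroup_two_even_holds`.
[cite: HeathBrown1994SelmerCongruentII, Appendix (Monsky), typescript p. 41 L20–L36] -/
theorem hbMonskySelmerEven_proof : HBMonskySelmerEven :=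
  Literature.NumberTheory.EllipticCurves.HeathBrown1994.monsky_card_selmerGroup_two_even_holds

end Summit.BirchSwinnertonDyer.BirchSwinnertonDyer.Theorems

end
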